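import Literature.NumberTheory.Automorphic.CuspidalCohomologyGL
import Literature.NumberTheory.Automorphic.KugaLemmaDegreeOne
import Mathlib.LinearAlgebra.PiTensorProduct.Basis
import Mathlib.LinearAlgebra.Matrix.ToLin
import HarnessLib

/-!
# An admissible inner product on tensor powers, Weyl modules and the coefficient module `V_λ(ℂ)`

Topic `NumberTheory/Automorphic`; namespace `Literature.NumberTheory.Automorphic.AdmissibleForm`.
Definitions with bodies and theorems; no named fact, no `sorry`.

A finite-dimensional rational representation `(ρ, E)` of `GL_n` carries an ADMISSIBLE scalar
product: a positive definite Hermitian form for which `ρ(g)* = ρ(gᴴ)` — so that the compact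
`U(n) = {gᴴ g = 1}` acts unitarily and the Hermitian matrices (`𝔭`) act by self-adjoint operators
[cite: BorelWallach2000, II §2.1–2.2] [cite: MatsushimaMurakami1963, §3].  For the polynomial
representations realised in tensor space this is the restriction of the standard form on
`(ℂ^σ)^{⊗d}` making the pure tensors of the standard basis orthonormal; we build it on the tree's
objects:

* `stdForm v w = ∑ i, conj (v i) * w i` on `σ → ℂ` (conjugate-linear in the FIRST slot, the
  convention of `Kuga.IsPosForm`); `isPosForm_stdForm`; `stdForm_mulVec_left`:
  `⟨A v, w⟩ = ⟨v, Aᴴ w⟩` for every matrix `A`;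
* `tpBasis σ d` — the basis of pure standard tensors of `TensorPower ℂ d (σ → ℂ)`
  (Mathlib `Basis.piTensorProduct`), `tpForm σ d` — the standard form in these coordinates,
  `isPosForm_tpForm`; `tpMap σ d A = ⨂_a (A a *ᵥ ·)` for a family of matrices, its matrix
  `toMatrix_tpMap … I J = ∏ a, A a (I a) (J a)`, and **`tpForm_tpMap_left`**:
  `⟨(⨂ A_a) t, t'⟩ = ⟨t, (⨂ A_aᴴ) t'⟩`; in particular for the diagonal action of `GL σ ℂ`
  (`glTensorRep`, column convention) `⟨ρ(g) t, t'⟩ = ⟨t, ρ(g⋆) t'⟩` (`tpForm_glTensorRep_left`,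
  `star g` the unit with matrix `gᴴ`) and `U(σ)`-invariance (`tpForm_glTensorRep_unitary`);
* `coeffForm n λ` — the restriction to the coefficient module
  `GLnCohomology.CoeffModule ℂ n λ = S_μ(ℂⁿ) ⊗ det^{λ_{n-1}}` (a Weyl submodule of tensor space,
  twisted by a power of `det`): `isPosForm_coeffForm` and **`coeffForm_coeffRepGL_left`**:
  `⟨V_λ(g) v, w⟩ = ⟨v, V_λ(g⋆) w⟩` (`det (gᴴ) = conj (det g)`), `coeffForm_coeffRepGL_unitary`.

This is input (b) of Step 2 of Borel's injectivity of cuspidal cohomology in the cone model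
(`ResGLnCuspidalCohomologyApex`): the positive form on `W ⊗ E` against which Kuga's lemma
(`ChevalleyEilenbergKugaAdjoint`) is run is Petersson ⊗ admissible.

## References

* A. Borel, N. Wallach, *Continuous cohomology, discrete subgroups, and representations of reductive
  groups*, 2nd ed. (2000), II §2.1–2.2 (admissible scalar products; held). [BorelWallach2000]
* Y. Matsushima, S. Murakami, *On vector bundle valued harmonic forms and automorphic forms on
  symmetric Riemannian manifolds*, Ann. of Math. 78 (1963), §3. [MatsushimaMurakami1963]
* W. Fulton, J. Harris, *Representation Theory*, GTM 129, §6.1, §15.5. [FultonHarrisGTM129]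
-/

noncomputable section

open scoped ComplexConjugate Matrix TensorProduct
open Finset PiTensorProduct Literature.NumberTheory.DiophantineGeometry

namespace Literature.NumberTheory.Automorphic

namespace AdmissibleForm

/-! ### The standard form on `ℂ^σ` -/

section Std

variable {σ : Type*} [Fintype σ]

/-- **The standard positive Hermitian form** `⟨v, w⟩ = ∑ i, conj (v i) * w i` on `σ → ℂ`
(conjugate-linear in the first variable). [folklore] -/
def stdForm (v w : σ → ℂ) : ℂ :=
  ∑ i, conj (v i) * w i

/-- Unfolding. [folklore] -/
theorem stdForm_apply (v w : σ → ℂ) : stdForm v w = ∑ i, conj (v i) * w i :=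
  rfl

/-- `⟨v, v⟩ = ∑ |v i|²`. [folklore] -/
theorem stdForm_self (v : σ → ℂ) : stdForm v v = ((∑ i, Complex.normSq (v i) : ℝ) : ℂ) := by
  rw [stdForm_apply, Complex.ofReal_sum]
  exact Finset.sum_congr rfl fun i _ => Complex.normSq_eq_conj_mul_self.symm

/-- The standard form is positive definite Hermitian. [folklore] -/
theorem isPosForm_stdForm : Kuga.IsPosForm (stdForm (σ := σ)) where
  add_left x y z := by
    simp only [stdForm_apply, Pi.add_apply, map_add, add_mul, sum_add_distrib]
  smul_left c x y := by
    simp only [stdForm_apply, Pi.smul_apply, smul_eq_mul, map_mul, mul_sum, mul_assoc]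
  conj_symm x y := by
    simp only [stdForm_apply, map_sum, map_mul, Complex.conj_conj, mul_comm]
  nonneg x := by
    rw [stdForm_self, Complex.ofReal_re]
    exact sum_nonneg fun i _ => Complex.normSq_nonneg _
  definite x hx := by
    rw [stdForm_self, Complex.ofReal_eq_zero] at hx
    have h := (sum_eq_zero_iff_of_nonneg fun i _ => Complex.normSq_nonneg (x i)).1 hx
    exact funext fun i => Complex.normSq_eq_zero.1 (h i (mem_univ i))

/-- **`⟨A v, w⟩ = ⟨v, Aᴴ w⟩`** for every square matrix `A`. [folklore] -/
theorem stdForm_mulVec_left (A : Matrix σ σ ℂ) (v w : σ → ℂ) :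
    stdForm (A *ᵥ v) w = stdForm v (Aᴴ *ᵥ w) := by
  simp only [stdForm_apply, Matrix.mulVec, dotProduct, map_sum, map_mul, sum_mul, mul_sum,
    Matrix.conjTranspose_apply, Complex.star_def]
  rw [sum_comm]
  exact sum_congr rfl fun j _ => sum_congr rfl fun i _ => by ring

end Std

/-! ### Tensor powers of `ℂ^σ` -/

section TensorPower

variable (σ : Type*) [Fintype σ] [DecidableEq σ] (d : ℕ)

/-- The basis of pure standard tensors `e_I = ⨂_a e_{I a}` of `(ℂ^σ)^{⊗d}`, indexed by
`I : Fin d → σ` (Mathlib `Basis.piTensorProduct`). [folklore] -/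
def tpBasis : Module.Basis (Fin d → σ) ℂ (TensorPower ℂ d (σ → ℂ)) :=
  Basis.piTensorProduct fun _ : Fin d => Pi.basisFun ℂ σ

/-- `e_I = ⨂_a e_{I a}`. [folklore] -/
theorem tpBasis_apply (I : Fin d → σ) :
    tpBasis σ d I = tprod ℂ fun a => (Pi.single (I a) (1 : ℂ) : σ → ℂ) := by
  rw [tpBasis, Basis.piTensorProduct_apply]
  simp only [Pi.basisFun_apply]

omit [DecidableEq σ] in
/-- Coordinates of a pure tensor: `(⨂ v_a)_I = ∏_a v_a (I a)`. [folklore] -/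
theorem tpBasis_repr_tprod (v : Fin d → σ → ℂ) (I : Fin d → σ) :
    (tpBasis σ d).repr (tprod ℂ v) I = ∏ a, v a (I a) := by
  rw [tpBasis, Basis.piTensorProduct_repr_tprod_apply]
  simp only [Pi.basisFun_repr]

/-- **The standard Hermitian form on `(ℂ^σ)^{⊗d}`**: the pure standard tensors are orthonormal,
`⟨t, t'⟩ = ∑_I conj (t_I) * t'_I`. [cite: BorelWallach2000, II §2.2] -/
def tpForm (t t' : TensorPower ℂ d (σ → ℂ)) : ℂ :=
  stdForm (⇑((tpBasis σ d).repr t)) (⇑((tpBasis σ d).repr t'))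

omit [DecidableEq σ] in
/-- Unfolding. [folklore] -/
theorem tpForm_apply (t t' : TensorPower ℂ d (σ → ℂ)) :
    tpForm σ d t t' = stdForm (⇑((tpBasis σ d).repr t)) (⇑((tpBasis σ d).repr t')) :=
  rfl

omit [DecidableEq σ] in
/-- The standard form on tensor space is positive definite Hermitian. [folklore] -/
theorem isPosForm_tpForm : Kuga.IsPosForm (tpForm σ d) where
  add_left x y z := by
    rw [tpForm_apply, tpForm_apply, tpForm_apply, map_add, Finsupp.coe_add, isPosForm_stdForm.add_left]
  smul_left c x y := by
    rw [tpForm_apply, tpForm_apply, map_smul, Finsupp.coe_smul, isPosForm_stdForm.smul_left]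
  conj_symm x y := by
    rw [tpForm_apply, tpForm_apply, isPosForm_stdForm.conj_symm]
  nonneg x := isPosForm_stdForm.nonneg _
  definite x hx := by
    have h := isPosForm_stdForm.definite _ hx
    have h' : (tpBasis σ d).repr x = 0 := Finsupp.ext fun I => congrFun h I
    exact (LinearEquiv.map_eq_zero_iff _).1 h'

/-- The tensor product `⨂_a A_a` of a family of matrices acting on `(ℂ^σ)^{⊗d}` (columns:
`v ↦ A *ᵥ v` in each slot). [folklore] -/
def tpMap (A : Fin d → Matrix σ σ ℂ) : TensorPower ℂ d (σ → ℂ) →ₗ[ℂ] TensorPower ℂ d (σ → ℂ) :=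
  PiTensorProduct.map fun a => Matrix.mulVecLin (A a)

omit [DecidableEq σ] in
/-- `(⨂ A_a) (⨂ v_a) = ⨂ (A_a v_a)`. [folklore] -/
theorem tpMap_tprod (A : Fin d → Matrix σ σ ℂ) (v : Fin d → σ → ℂ) :
    tpMap σ d A (tprod ℂ v) = tprod ℂ fun a => A a *ᵥ v a :=
  PiTensorProduct.map_tprod _ v

omit [DecidableEq σ] in
/-- `⨂ (A_a B_a) = (⨂ A_a) ∘ (⨂ B_a)`. [folklore] -/
theorem tpMap_mul (A B : Fin d → Matrix σ σ ℂ) :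
    tpMap σ d (fun a => A a * B a) = tpMap σ d A ∘ₗ tpMap σ d B := by
  rw [tpMap, tpMap, tpMap, ← PiTensorProduct.map_comp]
  congr 1
  funext a
  exact Matrix.mulVecLin_mul (A a) (B a)

/-- `⨂ 1 = id`. [folklore] -/
theorem tpMap_one : tpMap σ d (fun _ => (1 : Matrix σ σ ℂ)) = LinearMap.id := by
  rw [tpMap, ← PiTensorProduct.map_id]
  congr 1
  funext a
  exact Matrix.mulVecLin_one

/-- The diagonal action of `GL σ ℂ` on tensor space is `⨂_a g`. [folklore] -/
theorem glTensorRep_eq_tpMap (g : GL σ ℂ) :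
    (glTensorRep σ ℂ d g : TensorPower ℂ d (σ → ℂ) →ₗ[ℂ] TensorPower ℂ d (σ → ℂ)) =
      tpMap σ d fun _ => (g : Matrix σ σ ℂ) := by
  refine PiTensorProduct.ext (MultilinearMap.ext fun v => ?_)
  simp only [LinearMap.compMultilinearMap_apply, glTensorRep_tprod, tpMap_tprod]

/-- **Matrix coefficients of `⨂ A_a` in the standard tensor basis**:
`(⨂ A_a)_{I J} = ∏_a (A_a)_{I a, J a}`. [folklore] -/
theorem toMatrix_tpMap (A : Fin d → Matrix σ σ ℂ) (I J : Fin d → σ) :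
    LinearMap.toMatrix (tpBasis σ d) (tpBasis σ d) (tpMap σ d A) I J = ∏ a, A a (I a) (J a) := by
  rw [LinearMap.toMatrix_apply, tpBasis_apply, tpMap_tprod, tpBasis_repr_tprod]
  refine prod_congr rfl fun a _ => ?_
  rw [Matrix.mulVec_single_one]
  rfl

/-- The matrix of `⨂ A_aᴴ` is the conjugate transpose of the matrix of `⨂ A_a`. [folklore] -/
theorem toMatrix_tpMap_conjTranspose (A : Fin d → Matrix σ σ ℂ) :
    LinearMap.toMatrix (tpBasis σ d) (tpBasis σ d) (tpMap σ d fun a => (A a)ᴴ) =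
      (LinearMap.toMatrix (tpBasis σ d) (tpBasis σ d) (tpMap σ d A))ᴴ := by
  ext I J
  rw [Matrix.conjTranspose_apply, toMatrix_tpMap, toMatrix_tpMap, Complex.star_def, map_prod]
  exact prod_congr rfl fun a _ => Matrix.conjTranspose_apply _ _ _

/-- **Admissibility on tensor space**: `⟨(⨂ A_a) t, t'⟩ = ⟨t, (⨂ A_aᴴ) t'⟩`.
[cite: BorelWallach2000, II §2.2] -/
theorem tpForm_tpMap_left (A : Fin d → Matrix σ σ ℂ) (t t' : TensorPower ℂ d (σ → ℂ)) :
    tpForm σ d (tpMap σ d A t) t' = tpForm σ d t (tpMap σ d (fun a => (A a)ᴴ) t') := by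
  rw [tpForm_apply, tpForm_apply, ← LinearMap.toMatrix_mulVec_repr (tpBasis σ d) (tpBasis σ d) (tpMap σ d A) t,
    ← LinearMap.toMatrix_mulVec_repr (tpBasis σ d) (tpBasis σ d) (tpMap σ d fun a => (A a)ᴴ) t',
    toMatrix_tpMap_conjTranspose, stdForm_mulVec_left]

/-- The matrix of `star g` (`g ∈ GL σ ℂ = (Matrix σ σ ℂ)ˣ`) is `gᴴ`. [folklore] -/
theorem coe_star_GL (g : GL σ ℂ) : ((star g : GL σ ℂ) : Matrix σ σ ℂ) = (g : Matrix σ σ ℂ)ᴴ := by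
  rw [Units.coe_star, Matrix.star_eq_conjTranspose]

/-- **`⟨ρ(g) t, t'⟩ = ⟨t, ρ(g⋆) t'⟩`** for the diagonal action of `GL σ ℂ` on tensor space.
[cite: BorelWallach2000, II §2.2] -/
theorem tpForm_glTensorRep_left (g : GL σ ℂ) (t t' : TensorPower ℂ d (σ → ℂ)) :
    tpForm σ d (glTensorRep σ ℂ d g t) t' = tpForm σ d t (glTensorRep σ ℂ d (star g) t') := by
  rw [glTensorRep_eq_tpMap, glTensorRep_eq_tpMap, tpForm_tpMap_left]
  simp only [coe_star_GL]

/-- **Unitary invariance**: `⟨ρ(u) t, ρ(u) t'⟩ = ⟨t, t'⟩` for `uᴴ u = 1`.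
[cite: BorelWallach2000, II §2.2] -/
theorem tpForm_glTensorRep_unitary (u : GL σ ℂ) (hu : (u : Matrix σ σ ℂ)ᴴ * (u : Matrix σ σ ℂ) = 1)
    (t t' : TensorPower ℂ d (σ → ℂ)) :
    tpForm σ d (glTensorRep σ ℂ d u t) (glTensorRep σ ℂ d u t') = tpForm σ d t t' := by
  rw [glTensorRep_eq_tpMap, tpForm_tpMap_left, ← LinearMap.comp_apply, ← tpMap_mul]
  simp only [hu, tpMap_one, LinearMap.id_apply]

end TensorPower

/-! ### The coefficient module `V_λ(ℂ) = S_μ(ℂⁿ) ⊗ det^{λ_{n-1}}` -/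

section Coeff

variable (n : ℕ) (wt : Fin n → ℤ)

/-- **The admissible form on `V_λ(ℂ)`**: the restriction of the standard form on tensor space to
the Weyl submodule. [cite: BorelWallach2000, II §2.2] -/
def coeffForm (v w : GLnCohomology.CoeffModule ℂ n wt) : ℂ :=
  tpForm (Fin n) (GLnCohomology.coeffDegree wt)
    ((GLnCohomology.CoeffModule.toWeyl ℂ v : weylModule ℂ (Fin n) (GLnCohomology.coeffPartition wt)) :
      TensorPower ℂ (GLnCohomology.coeffDegree wt) (Fin n → ℂ))
    ((GLnCohomology.CoeffModule.toWeyl ℂ w : weylModule ℂ (Fin n) (GLnCohomology.coeffPartition wt)) :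
      TensorPower ℂ (GLnCohomology.coeffDegree wt) (Fin n → ℂ))

/-- Unfolding: the form of the underlying tensors. [folklore] -/
theorem coeffForm_apply (v w : GLnCohomology.CoeffModule ℂ n wt) :
    coeffForm n wt v w = tpForm (Fin n) (GLnCohomology.coeffDegree wt)
      ((GLnCohomology.CoeffModule.toWeyl ℂ v : weylModule ℂ (Fin n) (GLnCohomology.coeffPartition wt)) :
        TensorPower ℂ (GLnCohomology.coeffDegree wt) (Fin n → ℂ))
      ((GLnCohomology.CoeffModule.toWeyl ℂ w : weylModule ℂ (Fin n) (GLnCohomology.coeffPartition wt)) :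
        TensorPower ℂ (GLnCohomology.coeffDegree wt) (Fin n → ℂ)) :=
  rfl

/-- The admissible form on `V_λ(ℂ)` is positive definite Hermitian. [folklore] -/
theorem isPosForm_coeffForm : Kuga.IsPosForm (coeffForm n wt) where
  add_left _ _ _ := (isPosForm_tpForm (Fin n) _).add_left _ _ _
  smul_left c _ _ := (isPosForm_tpForm (Fin n) _).smul_left c _ _
  conj_symm _ _ := (isPosForm_tpForm (Fin n) _).conj_symm _ _
  nonneg _ := (isPosForm_tpForm (Fin n) _).nonneg _
  definite _ hx := Subtype.ext ((isPosForm_tpForm (Fin n) _).definite _ hx)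

/-- The underlying tensor of `V_λ(g) v` is `(det g)^{λ_{n-1}} • ρ(g) v̂`. [folklore] -/
theorem coe_coeffRepGL_apply (g : GL (Fin n) ℂ) (v : GLnCohomology.CoeffModule ℂ n wt) :
    ((GLnCohomology.CoeffModule.toWeyl ℂ (GLnCohomology.coeffRepGL ℂ n wt g v) :
        weylModule ℂ (Fin n) (GLnCohomology.coeffPartition wt)) :
      TensorPower ℂ (GLnCohomology.coeffDegree wt) (Fin n → ℂ)) =
      ((Matrix.GeneralLinearGroup.det g : ℂˣ) : ℂ) ^ GLnCohomology.lowestEntry wt •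
        glTensorRep (Fin n) ℂ (GLnCohomology.coeffDegree wt) g
          ((GLnCohomology.CoeffModule.toWeyl ℂ v : weylModule ℂ (Fin n) (GLnCohomology.coeffPartition wt)) :
            TensorPower ℂ (GLnCohomology.coeffDegree wt) (Fin n → ℂ)) := by
  rw [GLnCohomology.coeffRepGL_apply, Units.val_zpow_eq_zpow_val]
  change (((((Matrix.GeneralLinearGroup.det g : ℂˣ) : ℂ) ^ GLnCohomology.lowestEntry wt •
      weylRep ℂ (Fin n) (GLnCohomology.coeffPartition wt) g (GLnCohomology.CoeffModule.toWeyl ℂ v) :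
        weylModule ℂ (Fin n) (GLnCohomology.coeffPartition wt)) :
      TensorPower ℂ (GLnCohomology.coeffDegree wt) (Fin n → ℂ))) = _
  rw [Submodule.coe_smul, coe_weylRep_apply]

/-- `det (g⋆) = conj (det g)`. [folklore] -/
theorem det_star_GL {m : Type*} [Fintype m] [DecidableEq m] (g : GL m ℂ) :
    ((Matrix.GeneralLinearGroup.det (star g) : ℂˣ) : ℂ) = conj ((Matrix.GeneralLinearGroup.det g : ℂˣ) : ℂ) := by
  rw [Matrix.GeneralLinearGroup.val_det_apply, Matrix.GeneralLinearGroup.val_det_apply, coe_star_GL,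
    Matrix.det_conjTranspose, Complex.star_def]

/-- **Admissibility of `V_λ(ℂ)`**: `⟨V_λ(g) v, w⟩ = ⟨v, V_λ(g⋆) w⟩` (`g⋆` the unit with matrix
`gᴴ`; `det gᴴ = conj (det g)`).  Hence `U(n)` acts unitarily and Hermitian matrices act
self-adjointly. [cite: BorelWallach2000, II §2.1–2.2] [cite: MatsushimaMurakami1963, §3] -/
theorem coeffForm_coeffRepGL_left (g : GL (Fin n) ℂ) (v w : GLnCohomology.CoeffModule ℂ n wt) :
    coeffForm n wt (GLnCohomology.coeffRepGL ℂ n wt g v) w =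
      coeffForm n wt v (GLnCohomology.coeffRepGL ℂ n wt (star g) w) := by
  rw [coeffForm_apply, coeffForm_apply, coe_coeffRepGL_apply, coe_coeffRepGL_apply,
    (isPosForm_tpForm (Fin n) _).smul_left, (isPosForm_tpForm (Fin n) _).smul_right,
    tpForm_glTensorRep_left, det_star_GL, map_zpow₀]

/-- **Unitary invariance on `V_λ(ℂ)`**: `⟨V_λ(u) v, V_λ(u) w⟩ = ⟨v, w⟩` for `uᴴ u = 1`.
[cite: BorelWallach2000, II §2.2] -/
theorem coeffForm_coeffRepGL_unitary (u : GL (Fin n) ℂ)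
    (hu : (u : Matrix (Fin n) (Fin n) ℂ)ᴴ * (u : Matrix (Fin n) (Fin n) ℂ) = 1)
    (v w : GLnCohomology.CoeffModule ℂ n wt) :
    coeffForm n wt (GLnCohomology.coeffRepGL ℂ n wt u v) (GLnCohomology.coeffRepGL ℂ n wt u w) =
      coeffForm n wt v w := by
  -- `|det u| = 1`
  have hdet : conj ((Matrix.GeneralLinearGroup.det u : ℂˣ) : ℂ) * ((Matrix.GeneralLinearGroup.det u : ℂˣ) : ℂ) = 1 := by
    have h := congrArg Matrix.det hu
    rwa [Matrix.det_mul, Matrix.det_conjTranspose, Matrix.det_one, Complex.star_def,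
      ← Matrix.GeneralLinearGroup.val_det_apply] at h
  rw [coeffForm_apply, coeffForm_apply, coe_coeffRepGL_apply, coe_coeffRepGL_apply,
    (isPosForm_tpForm (Fin n) _).smul_left, (isPosForm_tpForm (Fin n) _).smul_right,
    tpForm_glTensorRep_unitary (Fin n) _ u hu, ← mul_assoc, map_zpow₀, ← mul_zpow, hdet, one_zpow, one_mul]

end Coeff

end AdmissibleForm

end Literature.NumberTheory.Automorphic

end
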